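import Literature.RingTheory.Derivation.MvPowerSeriesDerivations
import HarnessLib

/-!
# Coefficientwise derivations of a power series ring (Matsumura Thm. 30.5 (2), power-series form)

Topic: `Literature/RingTheory/Derivation`. In the Jacobian criterion over an imperfect field
(H. Matsumura, *Commutative Ring Theory*, Thm. 30.5 (2), p. 235 = PDF p. 252: "For any `p`-basis
`{u_γ}` of `k`, define `D_γ ∈ Der(S)` by `D_γ(u_γ') = δ_{γγ'}` and `D_γ(Xᵢ) = 0`") and in Nomura's /
Nagata's criteria over `K⟦X⟧` (Thm. 30.6–30.10) a derivation `D` of the COEFFICIENT ring is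
extended to the polynomial / power series ring by letting it act on the coefficients and kill the
variables. This file constructs that extension for `R⟦X_σ⟧` and records its defining properties:

* `Derivation.mvPowerSeriesCoeffwise D` — the derivation `f ↦ (n ↦ D (coeff n f))` of `R⟦X_σ⟧`
  (over the same base `A` as `D : Derivation A R R`), with `coeff_mvPowerSeriesCoeffwise`,
  `mvPowerSeriesCoeffwise_monomial`, `mvPowerSeriesCoeffwise_C`, `mvPowerSeriesCoeffwise_X`;
* `apply_eq_sum_pderiv_mul_add_coeffwise` — with Matsumura 30.6 (i)
  (`MvPowerSeriesDerivations.lean`): an `A`-derivation `E` of `R⟦X_σ⟧` (`σ` finite) which acts on the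
  constants through `D` equals `Σᵢ (∂/∂Xᵢ)(·) · E(Xᵢ) + D̃`.

[cite: Matsumura1987, Thm. 30.5 (2)]

## References

* H. Matsumura, *Commutative Ring Theory*, CUP 1986, Thm. 30.5 (2) (p. 235, PDF p. 252) and
  Thm. 30.6 (i) (p. 237, PDF pp. 254–255). [Matsumura1987]
-/

noncomputable section

namespace Literature.RingTheory.Derivation

universe u v w

open MvPowerSeries Literature.AlgebraicGeometry.Resolution

variable {A : Type w} [CommRing A] {R : Type u} [CommRing R] [Algebra A R] {σ : Type v}

/-- The underlying `A`-linear map of the coefficientwise extension: `(D̃ f)_n = D (f_n)`. [folklore] -/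
def coeffwiseLinearMap (D : _root_.Derivation A R R) : MvPowerSeries σ R →ₗ[A] MvPowerSeries σ R where
  toFun f := fun n => D (f n)
  map_add' f g := by
    ext n
    change D (f n + g n) = D (f n) + D (g n)
    rw [map_add]
  map_smul' a f := by
    ext n
    change D (a • f n) = a • D (f n)
    rw [D.map_smul]

/-- Coefficients of `coeffwiseLinearMap`. [folklore] -/
private theorem coeff_coeffwiseLinearMap (D : _root_.Derivation A R R) (f : MvPowerSeries σ R) (n : σ →₀ ℕ) :
    coeff n (coeffwiseLinearMap D f) = D (coeff n f) :=
  rfl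

/-- **The coefficientwise extension** of a derivation `D` of `R` to `R⟦X_σ⟧`: `(D̃ f)_n = D (f_n)`
(the power-series form of Matsumura's derivations `D_γ` of Thm. 30.5 (2), "`D_γ(u_γ') = δ_{γγ'}` and
`D_γ(Xᵢ) = 0`"). Leibniz: the `X^n`-coefficient of `f g` is `Σ_{p+q=n} f_p g_q`.
[cite: Matsumura1987, Thm. 30.5 (2)] -/
def _root_.Derivation.mvPowerSeriesCoeffwise (D : _root_.Derivation A R R) :
    _root_.Derivation A (MvPowerSeries σ R) (MvPowerSeries σ R) where
  __ := coeffwiseLinearMap (σ := σ) D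
  map_one_eq_zero' := by
    classical
    change coeffwiseLinearMap D (1 : MvPowerSeries σ R) = 0
    ext n
    rw [coeff_coeffwiseLinearMap, coeff_one, map_zero]
    split_ifs
    · exact D.map_one_eq_zero
    · exact map_zero D
  leibniz' f g := by
    classical
    change coeffwiseLinearMap D (f * g) = f • coeffwiseLinearMap D g + g • coeffwiseLinearMap D f
    ext n
    rw [coeff_coeffwiseLinearMap, smul_eq_mul, smul_eq_mul, mul_comm g, map_add, coeff_mul, coeff_mul,
      coeff_mul, map_sum, ← Finset.sum_add_distrib]
    refine Finset.sum_congr rfl fun p _ => ?_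
    rw [coeff_coeffwiseLinearMap, coeff_coeffwiseLinearMap, D.leibniz, smul_eq_mul, smul_eq_mul]
    ring

/-- `(D̃ f)_n = D (f_n)`. [cite: Matsumura1987, Thm. 30.5 (2)] -/
theorem coeff_mvPowerSeriesCoeffwise (D : _root_.Derivation A R R) (f : MvPowerSeries σ R)
    (n : σ →₀ ℕ) : coeff n (D.mvPowerSeriesCoeffwise f) = D (coeff n f) :=
  rfl

/-- `D̃ (a X^n) = (D a) X^n`. [cite: Matsumura1987, Thm. 30.5 (2)] -/
theorem mvPowerSeriesCoeffwise_monomial (D : _root_.Derivation A R R) (n : σ →₀ ℕ) (a : R) :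
    D.mvPowerSeriesCoeffwise (monomial n a : MvPowerSeries σ R) = monomial n (D a) := by
  classical
  ext m
  rw [coeff_mvPowerSeriesCoeffwise, coeff_monomial, coeff_monomial]
  split_ifs
  · rfl
  · exact map_zero D

/-- `D̃` acts on constants through `D`: `D̃ (C a) = C (D a)` ("`D_γ(u_γ') = δ`").
[cite: Matsumura1987, Thm. 30.5 (2)] -/
theorem mvPowerSeriesCoeffwise_C (D : _root_.Derivation A R R) (a : R) :
    D.mvPowerSeriesCoeffwise (C a : MvPowerSeries σ R) = C (D a) := by
  classical
  ext m
  rw [coeff_mvPowerSeriesCoeffwise, coeff_C, coeff_C]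
  split_ifs
  · rfl
  · exact map_zero D

/-- `D̃` kills the variables: `D̃ (Xᵢ) = 0` ("`D_γ(Xᵢ) = 0`"). [cite: Matsumura1987, Thm. 30.5 (2)] -/
theorem mvPowerSeriesCoeffwise_X (D : _root_.Derivation A R R) (i : σ) :
    D.mvPowerSeriesCoeffwise (X i : MvPowerSeries σ R) = 0 := by
  classical
  ext m
  rw [coeff_mvPowerSeriesCoeffwise, coeff_X, map_zero]
  split_ifs
  · exact D.map_one_eq_zero
  · exact map_zero D

/-- **`Der_A(R⟦X⟧) = ⟨∂/∂Xᵢ⟩ + (coefficientwise derivations)`** (Matsumura 30.5 (2) with 30.6 (i)): an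
`A`-derivation `E` of `R⟦X_σ⟧`, `σ` finite, which acts on the constants through a derivation `D` of
`R` (`E (C a) = C (D a)`) is `E f = Σᵢ (∂f/∂Xᵢ) · E(Xᵢ) + D̃ f` — indeed `E − D̃` kills the constants,
hence is an `R`-derivation, to which Nomura's formula applies. [cite: Matsumura1987, Thm. 30.6 (i)] -/
theorem apply_eq_sum_pderiv_mul_add_coeffwise [Fintype σ]
    (E : _root_.Derivation A (MvPowerSeries σ R) (MvPowerSeries σ R)) (D : _root_.Derivation A R R)
    (hE : ∀ a : R, E (C a : MvPowerSeries σ R) = C (D a)) (f : MvPowerSeries σ R) :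
    E f = (∑ i, MvPowerSeries.pderiv i f * E (X i)) + D.mvPowerSeriesCoeffwise f := by
  classical
  -- `F := E − D̃` kills the constants, hence is `R`-linear
  set F₀ := E - D.mvPowerSeriesCoeffwise with hF₀
  have hF₀C : ∀ a : R, F₀ (C a : MvPowerSeries σ R) = 0 := fun a => by
    rw [hF₀, Derivation.sub_apply, hE, mvPowerSeriesCoeffwise_C, sub_self]
  let F : _root_.Derivation R (MvPowerSeries σ R) (MvPowerSeries σ R) :=
    { toFun := F₀
      map_add' := fun x y => map_add F₀ x y
      map_smul' := fun r x => by
        change F₀ (r • x) = r • F₀ x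
        rw [smul_eq_C_mul, F₀.leibniz, hF₀C, smul_zero, add_zero, smul_eq_mul, smul_eq_C_mul]
      map_one_eq_zero' := F₀.map_one_eq_zero
      leibniz' := fun x y => F₀.leibniz x y }
  have hF : ∀ x, F x = F₀ x := fun _ => rfl
  have hFX : ∀ i, F (X i) = E (X i) := fun i => by
    rw [hF, hF₀, Derivation.sub_apply, mvPowerSeriesCoeffwise_X, sub_zero]
  have key := MvPowerSeriesDerivation.apply_eq_sum_pderiv_mul F f
  simp_rw [hFX, hF, hF₀, Derivation.sub_apply] at key
  rw [← sub_eq_iff_eq_add]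
  exact key

end Literature.RingTheory.Derivation

end
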